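import Summits.NavierStokesRegularity.NavierStokesRegularity.Theses.CoreLogGas
import Summits.NavierStokesRegularity.NavierStokesRegularity.Theorems.CoreLogGasBlowupIsLocallyDrivenStubEnstrophyControl
import Summits.NavierStokesRegularity.NavierStokesRegularity.Theorems.TypeICertificateLadderRungReynoldsOneH1Rate
import Literature.Analysis.FluidPDE.NSVorticityBKMHolds
import Literature.Analysis.FluidPDE.NSVorticityBKM
import Literature.Analysis.FluidPDE.ElgindiBlowup
import Literature.Analysis.FluidPDE.VorticityCalculus
import Mathlib.MeasureTheory.Measure.Lebesgue.EqHaar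

/-!
# Crux `CoreLogGas.BlowupIsLocallyDriven` (stmt-NavierStokesRegularity-11291), line `registered`:
# at a finite-time singularity the canonical vorticity cores collapse

`--supports stmt-NavierStokesRegularity-11291` (lead `prover-line-stmt-NavierStokesRegularity-11291-c1-0`, 2026-08-17).

The crux B and the remaining registered stub `stub_intermediateZone` (shell locality) quantify over the *admissible
triples* `(t, x, ρ)` of a maximal classical solution: `x` a DEEP near-maximum vorticity point
(`Ω(t) ≤ 2|ω(t,x)|`, `Ω(t) := ⨆ |ω(t,·)|`), `B(x,ρ)` an inscribed ball of the quarter-max set `{Ω(t) ≤ 4|ω(t,·)|}`,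
and `ρ` at least half the largest such radius (the *canonical core radius*). This file proves the structural fact
behind the lead's regime analysis (`Cruxes/BlowupIsLocallyDriven/Lines/registered.md`):

* `coresCollapse` — **at blow-up the canonical cores collapse**: for every maximal finite-energy classical solution
  from Clay data, every `ρ₀ > 0` and every `t₁ < T` there is a time `t ∈ [t₁, T)` carrying an admissible triple with
  core radius `ρ < ρ₀`. Proof: otherwise every admissible core radius on `[t₁,T)` is `≥ ρ₀`; at each such time an
  admissible triple EXISTS as soon as `Ω(t) > 0` (`coresCollapse_exists_admissible`: the vorticity slice is continuous,
  bounded — Tao-2013 Sobolev bounds on closed sub-slabs — and square integrable), so the quarter-max set contains a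
  ball of radius `ρ₀`, whence `(Ω(t)/4)² · |B_{ρ₀}| ≤ ‖ω(t)‖₂² ≤ 16‖∇u(t)‖₂²` (`coresCollapse_sq_mul_volume_le_integral`),
  i.e. `Ω(t) ≤ C(ρ₀) ‖∇u(t)‖₂`; since `t ↦ ‖∇u(t)‖₂ ∈ L¹(0,T)` (`stub_enstrophyControl`) and the vorticity is bounded
  on `[0,t₁]`, the Beale–Kato–Majda integral `∫₀ᵀ ‖ω‖_∞` is finite and the solution continues past `T`
  (`beale_kato_majda_holds`) — contradicting maximality.
* `shellLocality_of_collapseCase` — hence the shell stub is equivalent to its restriction to solutions with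
  collapsing cores: the registered statement `stub_intermediateZone` follows from the same statement under the extra
  hypothesis "cores collapse" (the non-collapsing case being vacuous by the choice `R = 1`, `M = max 1 (2/ρ₀)`), and
  that hypothesis is discharged by `coresCollapse`.

References: J. T. Beale, T. Kato, A. Majda, Comm. Math. Phys. 94 (1984), Thm. 1; T. Tao, arXiv:1108.1165 §11.
-/

noncomputable section

open Set MeasureTheory Filter Topology Metric
open scoped ContDiff ENNReal NNReal

-- justification: the stub namespace is fixed by the crux protocol (sibling stub files use the same one).
set_option linter.dupNamespace false

namespace Summit.NavierStokesRegularity.NavierStokesRegularity.Theorems.BlowupIsLocallyDriven.Registered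

open Literature.Analysis.FluidPDE

/-! ### Volume of balls in `ℝ³` -/

/-- `|B(x,r)| = r³ |B(0,1)|` in `ℝ³` (real-valued Haar scaling). [folklore] -/
theorem coresCollapse_volumeReal_ball (x : EuclideanSpace ℝ (Fin 3)) {r : ℝ} (hr : 0 ≤ r) :
    (volume : Measure (EuclideanSpace ℝ (Fin 3))).real (Metric.ball x r) =
      r ^ 3 * (volume : Measure (EuclideanSpace ℝ (Fin 3))).real (Metric.ball 0 1) := by
  simp only [Measure.real]
  rw [Measure.addHaar_ball volume x hr, finrank_euclideanSpace_fin, ENNReal.toReal_mul,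
    ENNReal.toReal_ofReal (pow_nonneg hr 3)]

/-- `0 < |B(0,1)| < ∞` in `ℝ³` (real-valued). [folklore] -/
theorem coresCollapse_volumeReal_unitBall_pos :
    0 < (volume : Measure (EuclideanSpace ℝ (Fin 3))).real (Metric.ball 0 1) :=
  ENNReal.toReal_pos (measure_ball_pos volume _ one_pos).ne' measure_ball_lt_top.ne

/-! ### A quarter-max ball forces enstrophy -/

/-- If `B(x,r) ⊆ {L ≤ 4‖w‖}` with `0 ≤ L`, `0 ≤ r` and `‖w‖²` integrable, then
`(L/4)² · (r³ |B(0,1)|) ≤ ∫ ‖w‖²`. [folklore] -/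
theorem coresCollapse_sq_mul_volume_le_integral {w : EuclideanSpace ℝ (Fin 3) → EuclideanSpace ℝ (Fin 3)}
    (hw : Integrable (fun y => ‖w y‖ ^ 2) volume) {L r : ℝ} (hL : 0 ≤ L) (hr : 0 ≤ r)
    {x : EuclideanSpace ℝ (Fin 3)} (hball : Metric.ball x r ⊆ {y | L ≤ 4 * ‖w y‖}) :
    (L / 4) ^ 2 * (r ^ 3 * (volume : Measure (EuclideanSpace ℝ (Fin 3))).real (Metric.ball 0 1)) ≤
      ∫ y, ‖w y‖ ^ 2 := by
  have hvol : (volume : Measure (EuclideanSpace ℝ (Fin 3))) (Metric.ball x r) < ⊤ := measure_ball_lt_top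
  calc (L / 4) ^ 2 * (r ^ 3 * (volume : Measure (EuclideanSpace ℝ (Fin 3))).real (Metric.ball 0 1))
      = ∫ _ in Metric.ball x r, (L / 4) ^ 2 := by
        rw [setIntegral_const, coresCollapse_volumeReal_ball x hr, smul_eq_mul, mul_comm]
    _ ≤ ∫ y in Metric.ball x r, ‖w y‖ ^ 2 := by
        refine setIntegral_mono_on (integrableOn_const hvol.ne) hw.integrableOn measurableSet_ball ?_
        intro y hy
        have h4 : L / 4 ≤ ‖w y‖ := by have := hball hy; simp only [mem_setOf_eq] at this; linarith
        exact pow_le_pow_left₀ (by linarith) h4 2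
    _ ≤ ∫ y, ‖w y‖ ^ 2 := setIntegral_le_integral hw (Eventually.of_forall fun _ => sq_nonneg _)

/-! ### Existence of a canonical admissible triple on a slice -/

/-- **A canonical core exists whenever the vorticity slice is nonzero.** For a continuous, square-integrable
field `w` with `0 < Ω := ⨆ ‖w‖` (so `w` is bounded, `Real.iSup` being `0` otherwise), there are a deep point `x` (`Ω ≤ 2‖w x‖`) and a radius `ρ > 0` with
`B(x,ρ) ⊆ {Ω ≤ 4‖w‖}` such that every other such radius is `≤ 2ρ` (take `ρ` above half the supremum `ρ*` of all
admissible radii; `ρ* < ∞` because a quarter-max ball of radius `r` carries enstrophy `≳ Ω² r³`). [folklore] -/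
theorem coresCollapse_exists_admissible {w : EuclideanSpace ℝ (Fin 3) → EuclideanSpace ℝ (Fin 3)}
    (hwc : Continuous w) (hw2 : Integrable (fun y => ‖w y‖ ^ 2) volume)
    (hΩ : 0 < ⨆ z, ‖w z‖) :
    ∃ (x : EuclideanSpace ℝ (Fin 3)) (ρ : ℝ), 0 < ρ ∧ (⨆ z, ‖w z‖) ≤ 2 * ‖w x‖ ∧
      Metric.ball x ρ ⊆ {y | (⨆ z, ‖w z‖) ≤ 4 * ‖w y‖} ∧
      ∀ (x' : EuclideanSpace ℝ (Fin 3)) (ρ' : ℝ), (⨆ z, ‖w z‖) ≤ 2 * ‖w x'‖ →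
        Metric.ball x' ρ' ⊆ {y | (⨆ z, ‖w z‖) ≤ 4 * ‖w y‖} → ρ' ≤ 2 * ρ := by
  set Ω : ℝ := ⨆ z, ‖w z‖ with hΩ_def
  -- a deep point
  obtain ⟨x₀, hx₀⟩ : ∃ x₀, Ω / 2 < ‖w x₀‖ := exists_lt_of_lt_ciSup (by rw [← hΩ_def]; linarith)
  have h1x₀ : Ω ≤ 2 * ‖w x₀‖ := by linarith
  -- the set of admissible radii
  set Rset : Set ℝ := {ρ' | ∃ x', Ω ≤ 2 * ‖w x'‖ ∧ Metric.ball x' ρ' ⊆ {y | Ω ≤ 4 * ‖w y‖}} with hRset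
  have hne : Rset.Nonempty := ⟨0, x₀, h1x₀, by simp⟩
  -- admissible radii are bounded (enstrophy)
  set v₁ : ℝ := (volume : Measure (EuclideanSpace ℝ (Fin 3))).real (Metric.ball 0 1) with hv₁
  have hv₁0 : 0 < v₁ := coresCollapse_volumeReal_unitBall_pos
  set I : ℝ := ∫ y, ‖w y‖ ^ 2 with hI
  have hbdd : BddAbove Rset := by
    refine ⟨max 1 (16 * I / (Ω ^ 2 * v₁)), ?_⟩
    rintro ρ' ⟨x', -, hball⟩
    rcases le_or_gt ρ' 1 with h | h
    · exact h.trans (le_max_left _ _)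
    · refine le_trans ?_ (le_max_right _ _)
      have hkey := coresCollapse_sq_mul_volume_le_integral hw2 hΩ.le (zero_le_one.trans h.le) hball
      have hΩv : 0 < Ω ^ 2 * v₁ := by positivity
      rw [le_div_iff₀ hΩv]
      have hρ3 : ρ' ≤ ρ' ^ 3 := by
        have hsq : 1 ≤ ρ' ^ 2 := by nlinarith
        calc ρ' = ρ' * 1 := (mul_one _).symm
          _ ≤ ρ' * ρ' ^ 2 := mul_le_mul_of_nonneg_left hsq (by linarith)
          _ = ρ' ^ 3 := by ring
      nlinarith [hkey, hρ3, mul_le_mul_of_nonneg_left hρ3 hΩv.le]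
  set ρs : ℝ := sSup Rset with hρs
  -- a small ball around the deep point is admissible, so `ρ* > 0`
  have hopen : IsOpen {y | Ω / 4 < ‖w y‖} := isOpen_lt continuous_const hwc.norm
  have hx₀mem : x₀ ∈ {y | Ω / 4 < ‖w y‖} := by simp only [mem_setOf_eq]; linarith
  obtain ⟨δ, hδ, hδball⟩ := Metric.isOpen_iff.1 hopen x₀ hx₀mem
  have hδR : δ ∈ Rset := ⟨x₀, h1x₀, fun y hy => by
    have := hδball hy; simp only [mem_setOf_eq] at this ⊢; linarith⟩
  have hρs_pos : 0 < ρs := hδ.trans_le (le_csSup hbdd hδR)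
  -- a radius above half the supremum
  obtain ⟨ρ, ⟨x, h1x, hballx⟩, hρ⟩ := exists_lt_of_lt_csSup hne (half_lt_self hρs_pos)
  refine ⟨x, ρ, by linarith, h1x, hballx, fun x' ρ' h1' h2' => ?_⟩
  have : ρ' ≤ ρs := le_csSup hbdd ⟨x', h1', h2'⟩
  linarith

/-! ### Slices of a classical Leray–Hopf solution: bounded vorticity, enstrophy -/

/-- Bounded Sobolev norms on every closed initial sub-slab `[0,T'']`, `T'' < T` (Tao 2013 Cor. 11.1, via the tree's
`RungReynoldsOne.hasBoundedSobolevNormsOn_subslab`), in the form the Beale–Kato–Majda fact consumes. [cite: Tao2011, Cor. 11.1] -/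
theorem coresCollapse_hasBoundedSobolevNormsOn {ν T : ℝ} (hν : 0 < ν) (hT : 0 < T)
    {u : ℝ → EuclideanSpace ℝ (Fin 3) → EuclideanSpace ℝ (Fin 3)} {p : ℝ → EuclideanSpace ℝ (Fin 3) → ℝ}
    (hcl : IsClassicalNSSolutionOn (Ico 0 T) ν 0 u p) (hLH : IsLerayHopfOn T ν 0 (u 0) u)
    (hdec : HasRapidSpatialDecay (u 0)) :
    ∀ T'' < T, HasBoundedSobolevNormsOn (Icc 0 T'') u := by
  intro T'' hT''
  have h1 : 0 < max T'' (T / 2) := lt_max_of_lt_right (by linarith)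
  have h2 : max T'' (T / 2) < T := max_lt hT'' (by linarith)
  exact (RungReynoldsOne.hasBoundedSobolevNormsOn_subslab hν hcl hLH hdec h1 h2).mono
    (Icc_subset_Icc_right (le_max_left _ _))

/-- The vorticity of every slice `t < T` is bounded (as a real-valued function). [folklore] -/
theorem coresCollapse_bddAbove_curl {ν T : ℝ} (hν : 0 < ν) (hT : 0 < T)
    {u : ℝ → EuclideanSpace ℝ (Fin 3) → EuclideanSpace ℝ (Fin 3)} {p : ℝ → EuclideanSpace ℝ (Fin 3) → ℝ}
    (hcl : IsClassicalNSSolutionOn (Ico 0 T) ν 0 u p) (hLH : IsLerayHopfOn T ν 0 (u 0) u)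
    (hdec : HasRapidSpatialDecay (u 0)) {t : ℝ} (ht : t ∈ Ico 0 T) :
    BddAbove (range fun z => ‖curl (u t) z‖) := by
  have hT₁ : (t + T) / 2 < T := by linarith [ht.2]
  have hB := coresCollapse_hasBoundedSobolevNormsOn hν hT hcl hLH hdec _ hT₁
  obtain ⟨R, hR, hRb⟩ := exists_enorm_curl_le_of_hasBoundedSobolevNormsOn
    (fun s hs => hcl.contDiff_velocity ⟨hs.1, hs.2.trans_lt hT₁⟩) hB
  refine ⟨R.toReal, ?_⟩
  rintro _ ⟨z, rfl⟩
  have htI : t ∈ Icc 0 ((t + T) / 2) := ⟨ht.1, by linarith [ht.2]⟩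
  have h := hRb t htI z
  rw [← ofReal_norm] at h
  exact (ENNReal.ofReal_le_iff_le_toReal hR.ne).1 h

/-- `‖curl v‖²` is integrable with `∫‖curl v‖² ≤ 16 ∫‖∇v‖²` when `∇v ∈ L²` (`|curl v| ≤ 4‖Dv‖`). [folklore] -/
theorem coresCollapse_integral_curl_sq_le {v : EuclideanSpace ℝ (Fin 3) → EuclideanSpace ℝ (Fin 3)}
    (hv : ContDiff ℝ 1 v) (hgrad : Integrable (fun y => ‖fderiv ℝ v y‖ ^ 2) volume) :
    Integrable (fun y => ‖curl v y‖ ^ 2) volume ∧ ∫ y, ‖curl v y‖ ^ 2 ≤ 16 * ∫ y, ‖fderiv ℝ v y‖ ^ 2 := by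
  have hle : ∀ y, ‖curl v y‖ ^ 2 ≤ 16 * ‖fderiv ℝ v y‖ ^ 2 := fun y => by
    have h := norm_curl_le_four_mul v y
    nlinarith [norm_nonneg (curl v y), h]
  have hint : Integrable (fun y => ‖curl v y‖ ^ 2) volume :=
    (hgrad.const_mul 16).mono' ((continuous_curl hv).norm.pow 2).aestronglyMeasurable
      (Eventually.of_forall fun y => by
        rw [Real.norm_eq_abs, abs_of_nonneg (sq_nonneg _)]; exact hle y)
  refine ⟨hint, ?_⟩
  calc ∫ y, ‖curl v y‖ ^ 2 ≤ ∫ y, 16 * ‖fderiv ℝ v y‖ ^ 2 := integral_mono hint (hgrad.const_mul 16) hle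
    _ = 16 * ∫ y, ‖fderiv ℝ v y‖ ^ 2 := integral_const_mul _ _

/-! ### The main theorem: cores collapse at blow-up -/

/-- **At a finite-time singularity the canonical vorticity cores collapse.** For a maximal finite-energy classical
solution from Clay data (`IsMaximalSmoothSolution` + Leray–Hopf + rapidly decaying datum), for every `ρ₀ > 0` and every
`t₁ ∈ [0,T)` there is `t ∈ [t₁,T)` with an admissible triple of the crux `BlowupIsLocallyDriven` — a deep near-maximum
vorticity point `x` and a canonical core radius `ρ` (inscribed quarter-max ball, at least half the largest one) — of
radius `ρ < ρ₀`. Otherwise `Ω(t) ≤ C(ρ₀)‖∇u(t)‖₂ ∈ L¹(t₁,T)` and the Beale–Kato–Majda criterion continues the solution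
past `T`. [cite: BealeKatoMajda1984, Theorem 1] -/
theorem coresCollapse :
    ∀ (ν T : ℝ), 0 < ν → 0 < T →
    ∀ (u : ℝ → EuclideanSpace ℝ (Fin 3) → EuclideanSpace ℝ (Fin 3)) (p : ℝ → EuclideanSpace ℝ (Fin 3) → ℝ),
      Literature.Analysis.FluidPDE.IsMaximalSmoothSolution ν 0 u p T →
      Literature.Analysis.FluidPDE.IsLerayHopfOn T ν 0 (u 0) u →
      Literature.Analysis.FluidPDE.HasRapidSpatialDecay (u 0) →
      ∀ (ρ₀ : ℝ), 0 < ρ₀ → ∀ t₁ ∈ Set.Ico 0 T, ∃ t ∈ Set.Ico t₁ T,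
        ∃ (x : EuclideanSpace ℝ (Fin 3)) (ρ : ℝ), 0 < ρ ∧ ρ < ρ₀ ∧
          (⨆ z, ‖Literature.Analysis.FluidPDE.curl (u t) z‖) ≤ 2 * ‖Literature.Analysis.FluidPDE.curl (u t) x‖ ∧
          Metric.ball x ρ ⊆ {y | (⨆ z, ‖Literature.Analysis.FluidPDE.curl (u t) z‖) ≤ 4 * ‖Literature.Analysis.FluidPDE.curl (u t) y‖} ∧
          (∀ (x' : EuclideanSpace ℝ (Fin 3)) (ρ' : ℝ),
            (⨆ z, ‖Literature.Analysis.FluidPDE.curl (u t) z‖) ≤ 2 * ‖Literature.Analysis.FluidPDE.curl (u t) x'‖ →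
            Metric.ball x' ρ' ⊆ {y | (⨆ z, ‖Literature.Analysis.FluidPDE.curl (u t) z‖) ≤ 4 * ‖Literature.Analysis.FluidPDE.curl (u t) y‖} →
            ρ' ≤ 2 * ρ) := by
  intro ν T hν hT u p hmax hLH hdec ρ₀ hρ₀ t₁ ht₁
  by_contra hno
  -- `hno : ¬ ∃ t ∈ Ico t₁ T, ∃ x ρ, 0 < ρ ∧ ρ < ρ₀ ∧ h1 ∧ h2 ∧ h3`
  have hcl : IsClassicalNSSolutionOn (Ico 0 T) ν 0 u p := hmax.1
  obtain ⟨hint, hsq⟩ := stub_enstrophyControl ν T hν hT u p hcl hLH hdec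
  set v₁ : ℝ := (volume : Measure (EuclideanSpace ℝ (Fin 3))).real (Metric.ball 0 1) with hv₁
  have hv₁0 : 0 < v₁ := coresCollapse_volumeReal_unitBall_pos
  set c₀ : ℝ := ρ₀ ^ 3 * v₁ with hc₀
  have hc₀0 : 0 < c₀ := by positivity
  set K : ℝ := 16 / Real.sqrt c₀ with hK
  have hK0 : 0 ≤ K := by positivity
  -- Step A: on `[t₁, T)` the vorticity maximum is controlled by the enstrophy
  have hA : ∀ t ∈ Ico t₁ T, (⨆ z, ‖curl (u t) z‖) ≤ K * Real.sqrt (∫ y, ‖fderiv ℝ (u t) y‖ ^ 2) := by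
    intro t ht
    have ht' : t ∈ Ico 0 T := ⟨ht₁.1.trans ht.1, ht.2⟩
    set Ω : ℝ := ⨆ z, ‖curl (u t) z‖ with hΩ
    have hrhs : 0 ≤ K * Real.sqrt (∫ y, ‖fderiv ℝ (u t) y‖ ^ 2) := mul_nonneg hK0 (Real.sqrt_nonneg _)
    rcases le_or_gt Ω 0 with hΩ0 | hΩ0
    · exact hΩ0.trans hrhs
    · have hwc : Continuous (curl (u t)) :=
        continuous_curl ((hcl.contDiff_velocity ht').of_le (by exact_mod_cast le_top))
      obtain ⟨hw2, hw2le⟩ := coresCollapse_integral_curl_sq_le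
        ((hcl.contDiff_velocity ht').of_le (by exact_mod_cast le_top)) (hint t ht')
      obtain ⟨x, ρ, hρ, h1, h2, h3⟩ := coresCollapse_exists_admissible hwc hw2 hΩ0
      -- non-collapse: `ρ ≥ ρ₀`
      have hρρ₀ : ρ₀ ≤ ρ := by
        by_contra hlt
        exact hno ⟨t, ht, x, ρ, hρ, lt_of_not_ge hlt, h1, h2, h3⟩
      -- enstrophy lower bound on the ball of radius `ρ₀`
      have hballρ₀ : Metric.ball x ρ₀ ⊆ {y | Ω ≤ 4 * ‖curl (u t) y‖} := (ball_subset_ball hρρ₀).trans h2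
      have hkey := coresCollapse_sq_mul_volume_le_integral hw2 hΩ0.le hρ₀.le hballρ₀
      -- `(Ω/4)² c₀ ≤ 16 ∫‖∇u‖²`, i.e. `Ω ≤ K √(∫‖∇u‖²)`
      set I : ℝ := ∫ y, ‖fderiv ℝ (u t) y‖ ^ 2 with hI
      have hI0 : 0 ≤ I := integral_nonneg fun _ => sq_nonneg _
      have h16 : (Ω / 4) ^ 2 * c₀ ≤ 16 * I := hkey.trans hw2le
      have hΩsq : Ω ^ 2 ≤ 256 * I / c₀ := by
        rw [le_div_iff₀ hc₀0]; nlinarith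
      have hΩle : Ω ≤ Real.sqrt (256 * I / c₀) := (Real.le_sqrt hΩ0.le (by positivity)).2 hΩsq
      refine hΩle.trans (le_of_eq ?_)
      rw [Real.sqrt_div' _ hc₀0.le, Real.sqrt_mul (by norm_num) I,
        show Real.sqrt 256 = 16 by rw [show (256 : ℝ) = 16 ^ 2 by norm_num, Real.sqrt_sq (by norm_num)], hK]
      ring
  -- Step B: the vorticity is bounded on `[0, t₁]`
  have hreg := coresCollapse_hasBoundedSobolevNormsOn hν hT hcl hLH hdec
  have ht₂ : max t₁ (T / 2) < T := max_lt ht₁.2 (by linarith)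
  obtain ⟨R₁, hR₁, hR₁b⟩ := exists_enorm_curl_le_of_hasBoundedSobolevNormsOn
    (fun s hs => hcl.contDiff_velocity ⟨hs.1, hs.2.trans_lt ht₂⟩) (hreg _ ht₂)
  -- Step C: a pointwise majorant of the BKM integrand on `(0, T)`
  set G : ℝ → ℝ := fun t => K * Real.sqrt (∫ y, ‖fderiv ℝ (u t) y‖ ^ 2) with hG
  have hbound : ∀ t ∈ Ioo 0 T, (⨆ z, ‖curl (u t) z‖ₑ) ≤ R₁ + ENNReal.ofReal (G t) := by
    intro t ht
    refine iSup_le fun z => ?_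
    rcases le_or_gt t (max t₁ (T / 2)) with h | h
    · exact (hR₁b t ⟨ht.1.le, h⟩ z).trans le_self_add
    · have htI : t ∈ Ico t₁ T := ⟨(le_max_left _ _).trans h.le, ht.2⟩
      have ht' : t ∈ Ico 0 T := ⟨ht.1.le, ht.2⟩
      have hwb := coresCollapse_bddAbove_curl hν hT hcl hLH hdec ht'
      calc ‖curl (u t) z‖ₑ = ENNReal.ofReal ‖curl (u t) z‖ := (ofReal_norm _).symm
        _ ≤ ENNReal.ofReal (⨆ z, ‖curl (u t) z‖) := ENNReal.ofReal_le_ofReal (le_ciSup hwb z)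
        _ ≤ ENNReal.ofReal (G t) := ENNReal.ofReal_le_ofReal (hA t htI)
        _ ≤ R₁ + ENNReal.ofReal (G t) := le_add_self
  -- Step D: the BKM integral is finite
  have hGi : IntegrableOn G (Ioo 0 T) volume :=
    ((hsq.mono_set Ioo_subset_Ico_self).integrable.const_mul K)
  have hfin : (∫⁻ t in Ioo 0 T, ⨆ z, ‖curl (u t) z‖ₑ) < ⊤ := by
    calc (∫⁻ t in Ioo 0 T, ⨆ z, ‖curl (u t) z‖ₑ)
        ≤ ∫⁻ t in Ioo 0 T, (R₁ + ENNReal.ofReal (G t)) := setLIntegral_mono' measurableSet_Ioo hbound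
      _ = (∫⁻ _ in Ioo 0 T, R₁) + ∫⁻ t in Ioo 0 T, ENNReal.ofReal (G t) := by
          rw [lintegral_add_left' aemeasurable_const]
      _ < ⊤ := by
          refine ENNReal.add_lt_top.2 ⟨?_, ?_⟩
          · rw [setLIntegral_const, Real.volume_Ioo]
            exact ENNReal.mul_lt_top hR₁ ENNReal.ofReal_lt_top
          · calc (∫⁻ t in Ioo 0 T, ENNReal.ofReal (G t)) ≤ ∫⁻ t in Ioo 0 T, ‖G t‖ₑ :=
                  lintegral_mono fun t => Real.ofReal_le_enorm _
              _ < ⊤ := hGi.2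
  -- Step E: Beale–Kato–Majda continues the solution past `T`: contradiction with maximality
  exact hmax.2 ((beale_kato_majda_holds hν.le hT hcl hreg).2 hfin).hasSmoothExtensionPast

/-! ### The shell stub reduces to the collapsing-core case -/

/-- **Shell locality reduces to the collapsing-core regime.** The registered shell stub `stub_intermediateZone` of line
`registered` (conclusion verbatim) follows from the same statement restricted to solutions whose canonical cores
collapse (`∀ ρ₀ > 0, ∀ t₁ < T, ∃ t ∈ [t₁,T)` with an admissible triple of radius `< ρ₀`): by `coresCollapse` every
maximal solution is of that kind. (The complementary regime would be vacuous anyway: with `R = 1`, `M = max 1 (2/ρ₀)`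
no admissible triple has `Mρ ≤ R`.) [folklore] -/
theorem shellLocality_of_collapseCase
    (hC : ∀ (ν T : ℝ), 0 < ν → 0 < T →
    ∀ (u : ℝ → EuclideanSpace ℝ (Fin 3) → EuclideanSpace ℝ (Fin 3)) (p : ℝ → EuclideanSpace ℝ (Fin 3) → ℝ),
      Literature.Analysis.FluidPDE.IsMaximalSmoothSolution ν 0 u p T →
      Literature.Analysis.FluidPDE.IsLerayHopfOn T ν 0 (u 0) u →
      Literature.Analysis.FluidPDE.HasRapidSpatialDecay (u 0) →
      (∀ (ρ₀ : ℝ), 0 < ρ₀ → ∀ t₁ ∈ Set.Ico 0 T, ∃ t ∈ Set.Ico t₁ T,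
        ∃ (x : EuclideanSpace ℝ (Fin 3)) (ρ : ℝ), 0 < ρ ∧ ρ < ρ₀ ∧
          (⨆ z, ‖Literature.Analysis.FluidPDE.curl (u t) z‖) ≤ 2 * ‖Literature.Analysis.FluidPDE.curl (u t) x‖ ∧
          Metric.ball x ρ ⊆ {y | (⨆ z, ‖Literature.Analysis.FluidPDE.curl (u t) z‖) ≤ 4 * ‖Literature.Analysis.FluidPDE.curl (u t) y‖} ∧
          (∀ (x' : EuclideanSpace ℝ (Fin 3)) (ρ' : ℝ),
            (⨆ z, ‖Literature.Analysis.FluidPDE.curl (u t) z‖) ≤ 2 * ‖Literature.Analysis.FluidPDE.curl (u t) x'‖ →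
            Metric.ball x' ρ' ⊆ {y | (⨆ z, ‖Literature.Analysis.FluidPDE.curl (u t) z‖) ≤ 4 * ‖Literature.Analysis.FluidPDE.curl (u t) y‖} →
            ρ' ≤ 2 * ρ)) →
      ∃ (M t₀ R : ℝ) (g₁ : ℝ → ℝ), 1 ≤ M ∧ 0 ≤ t₀ ∧ t₀ < T ∧ 0 < R ∧
        MeasureTheory.IntegrableOn g₁ (Set.Ico t₀ T) ∧
        ∀ t ∈ Set.Ico t₀ T, ∀ (x : EuclideanSpace ℝ (Fin 3)) (ρ : ℝ), 0 < ρ → M * ρ ≤ R →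
          (⨆ z, ‖Literature.Analysis.FluidPDE.curl (u t) z‖) ≤ 2 * ‖Literature.Analysis.FluidPDE.curl (u t) x‖ →
          Metric.ball x ρ ⊆ {y | (⨆ z, ‖Literature.Analysis.FluidPDE.curl (u t) z‖) ≤ 4 * ‖Literature.Analysis.FluidPDE.curl (u t) y‖} →
          (∀ (x' : EuclideanSpace ℝ (Fin 3)) (ρ' : ℝ),
            (⨆ z, ‖Literature.Analysis.FluidPDE.curl (u t) z‖) ≤ 2 * ‖Literature.Analysis.FluidPDE.curl (u t) x'‖ →
            Metric.ball x' ρ' ⊆ {y | (⨆ z, ‖Literature.Analysis.FluidPDE.curl (u t) z‖) ≤ 4 * ‖Literature.Analysis.FluidPDE.curl (u t) y‖} →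
            ρ' ≤ 2 * ρ) →
          ∀ e : EuclideanSpace ℝ (Fin 3), ‖e‖ = 1 →
            |inner ℝ ((fderiv ℝ (fun z : EuclideanSpace ℝ (Fin 3) => ∫ y, (4 * Real.pi * ‖z - y‖ ^ 3)⁻¹ • Literature.Analysis.FluidPDE.cross ((Metric.ball x R).indicator (Literature.Analysis.FluidPDE.curl (u t)) y) (z - y)) x
              - fderiv ℝ (fun z : EuclideanSpace ℝ (Fin 3) => ∫ y, (4 * Real.pi * ‖z - y‖ ^ 3)⁻¹ • Literature.Analysis.FluidPDE.cross ((Metric.ball x (M * ρ)).indicator (Literature.Analysis.FluidPDE.curl (u t)) y) (z - y)) x) e) e|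
              ≤ g₁ t) :
    ∀ (ν T : ℝ), 0 < ν → 0 < T →
    ∀ (u : ℝ → EuclideanSpace ℝ (Fin 3) → EuclideanSpace ℝ (Fin 3)) (p : ℝ → EuclideanSpace ℝ (Fin 3) → ℝ),
      Literature.Analysis.FluidPDE.IsMaximalSmoothSolution ν 0 u p T →
      Literature.Analysis.FluidPDE.IsLerayHopfOn T ν 0 (u 0) u →
      Literature.Analysis.FluidPDE.HasRapidSpatialDecay (u 0) →
      ∃ (M t₀ R : ℝ) (g₁ : ℝ → ℝ), 1 ≤ M ∧ 0 ≤ t₀ ∧ t₀ < T ∧ 0 < R ∧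
        MeasureTheory.IntegrableOn g₁ (Set.Ico t₀ T) ∧
        ∀ t ∈ Set.Ico t₀ T, ∀ (x : EuclideanSpace ℝ (Fin 3)) (ρ : ℝ), 0 < ρ → M * ρ ≤ R →
          (⨆ z, ‖Literature.Analysis.FluidPDE.curl (u t) z‖) ≤ 2 * ‖Literature.Analysis.FluidPDE.curl (u t) x‖ →
          Metric.ball x ρ ⊆ {y | (⨆ z, ‖Literature.Analysis.FluidPDE.curl (u t) z‖) ≤ 4 * ‖Literature.Analysis.FluidPDE.curl (u t) y‖} →
          (∀ (x' : EuclideanSpace ℝ (Fin 3)) (ρ' : ℝ),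
            (⨆ z, ‖Literature.Analysis.FluidPDE.curl (u t) z‖) ≤ 2 * ‖Literature.Analysis.FluidPDE.curl (u t) x'‖ →
            Metric.ball x' ρ' ⊆ {y | (⨆ z, ‖Literature.Analysis.FluidPDE.curl (u t) z‖) ≤ 4 * ‖Literature.Analysis.FluidPDE.curl (u t) y‖} →
            ρ' ≤ 2 * ρ) →
          ∀ e : EuclideanSpace ℝ (Fin 3), ‖e‖ = 1 →
            |inner ℝ ((fderiv ℝ (fun z : EuclideanSpace ℝ (Fin 3) => ∫ y, (4 * Real.pi * ‖z - y‖ ^ 3)⁻¹ • Literature.Analysis.FluidPDE.cross ((Metric.ball x R).indicator (Literature.Analysis.FluidPDE.curl (u t)) y) (z - y)) x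
              - fderiv ℝ (fun z : EuclideanSpace ℝ (Fin 3) => ∫ y, (4 * Real.pi * ‖z - y‖ ^ 3)⁻¹ • Literature.Analysis.FluidPDE.cross ((Metric.ball x (M * ρ)).indicator (Literature.Analysis.FluidPDE.curl (u t)) y) (z - y)) x) e) e|
              ≤ g₁ t := by
  intro ν T hν hT u p hmax hLH hdec
  exact hC ν T hν hT u p hmax hLH hdec (coresCollapse ν T hν hT u p hmax hLH hdec)

end Summit.NavierStokesRegularity.NavierStokesRegularity.Theorems.BlowupIsLocallyDriven.Registered
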